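import Summits.BirchSwinnertonDyer.BirchSwinnertonDyer.Theorems.UniversalToricDescentResidualSelmerTransfer
import Summits.BirchSwinnertonDyer.BirchSwinnertonDyer.Theorems.UniversalToricDescentSigmaPassage
import HarnessLib

/-!
# Route UniversalToricDescent — the port-grade child B′1 `TorsionMuTransportModThree` of crux 20399 /
# `InvariantsTransportModThreeT`, in the route's currency (`Σ = ∅` on both curves): `Λ`-torsion and
# `μ = 0` of `X_{∅,0}(E/K_∞)` transported from a mod-`p` congruent twin — PROVED modulo only the
# decomposition facts the route already carries as leaves (Brink 20465/20466) and good reduction off `Σ`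

Lead prover bsd-wall-utd-p1 g6 (`--supports stmt-BirchSwinnertonDyer-20399`; PRICING-20399-ALG-HALF-utdp1g5 §3(a),
Split20399_B1_text_utdp1g5.lean). Composition of this seat's seven files: Λ-side
(`…AcDualMuZeroCriterion`), residual transport (`…ResidualSelmerTransport`), `E`-side (`…ResidualSelmerFinite`),
composition (`…ResidualSelmerComparison`), local lemma (H) (`…ResidualSelmerLocal`), unconditional transfer at
a common `Σ` (`…ResidualSelmerTransfer`) and the `Σ`-passage (`…SigmaPassage`).

* **`isTorsion_and_exists_generator_empty_transfer_of_modPCongruent`** — `W, W′/ℚ` elliptic with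
  `O6.ModPCongruent W′ W p`; `K` a number field; `κ` ANY `ℤ_p`-extension of `K` with topological generator
  `γ`; `p` odd; `𝔭 ∋ p` with `D_𝔭 ⊄ ker κ`; `Σ` a finite set of places `v ∤ p`, each with `D_v ⊄ ker κ`
  (finitely decomposed in `K_∞`), such that `W_K` and `W′_K` have good reduction at every `v ∉ Σ`, `v ∤ p`.
  If `X_ac^∅(W′_K) = AcSelmer.XAc (W′.baseChange K) p κ 𝔭 ∅ γ` is `Λ`-torsion with
  `Ch_Λ·R₀⟦T⟧ = (g′)`, `g′` with a norm-one coefficient, then the same holds for `X_ac^∅(W_K)`.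
  In the route (K imaginary quadratic, `κ` anticyclotomic, `p = 3`, `𝔭 = 𝔭′`, `Σ` = places over the primes
  of `N·N′` other than `3`): `D_𝔭 ⊄ ker κ` is Brink Cor. 1 (leaf 20466), `D_v ⊄ ker κ` for `v ∈ Σ` is
  Heegner(N), Heegner(N′) (split) + Brink Thm. 2 (leaf 20465), and good reduction off `Σ ∪ S_3` is the
  definition of `Σ` — so B′1 as typed is this theorem plus those leaf instantiations.

THEOREMS ONLY; no definition, no named fact, no `sorry`. BSD is not advanced by this file (B′1 is the
ALGEBRAIC half of 20399/T; the analytic half — congruence of tame-level measures, PRICING §4 — is untouched).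
References: [GreenbergVatsal2000] Thm. (1.4) (algebraic half), §2 Prop. (2.4), (2.8), p. 26; [Castella2018]
Def. 2.2, Thm. 2.3; [Brink2007] Thm. 2, Cor. 1; [LimSujatha2018] §3 Prop. 3.2.
-/

set_option autoImplicit false
-- `…BirchSwinnertonDyer.BirchSwinnertonDyer.Theorems…` is the problem's mandated namespace (D-0017).
set_option linter.dupNamespace false

noncomputable section

open scoped Classical

namespace Summit.BirchSwinnertonDyer.BirchSwinnertonDyer.Theorems.UniversalToricDescentTorsionMuTransport

open NumberField IsDedekindDomain Field
open Literature.NumberTheory.EllipticCurves Literature.NumberTheory.EllipticCurves.GreenbergSelmer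
  Literature.NumberTheory.GaloisRepresentations WeierstrassCurve
  Summit.BirchSwinnertonDyer.Rank1Residual.X11b Summit.BirchSwinnertonDyer.Rank1Residual.X11b.AcSelmer
  Summit.BirchSwinnertonDyer.Rank1Residual.O6
  Summit.BirchSwinnertonDyer.BirchSwinnertonDyer.Theorems.UniversalToricDescentAcDualMuZero
  Summit.BirchSwinnertonDyer.BirchSwinnertonDyer.Theorems.UniversalToricDescentResidualSelmerTransfer
  Summit.BirchSwinnertonDyer.BirchSwinnertonDyer.Theorems.UniversalToricDescentSigmaPassage

variable (W W' : WeierstrassCurve ℚ) [W.IsElliptic] [W'.IsElliptic] (K : Type) [Field K] [NumberField K]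
  {p : ℕ} [Fact p.Prime] (κ : ZpExtension K p) (𝔭 : HeightOneSpectrum (𝓞 K))
  (γ : absoluteGaloisGroup K) [Fact (κ.IsTopGenerator γ)] (S : Set (HeightOneSpectrum (𝓞 K)))

/-- **B′1 `TorsionMuTransportModThree` (generic `p`, `Σ = ∅` on both curves).** See the module docstring.
Chain: twin's torsion + unit coefficient ⟹ `Sel_𝔭^∅(K_∞, W′_K[p^∞])[p]` finite (Λ-side) ⟹ `Sel_𝔭^Σ` finite
(`Σ`-passage at the finitely decomposed `v ∈ Σ`) ⟹ `Sel_𝔭^Σ(K_∞, W_K[p^∞])[p]` finite (residual comparison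
along `W′_K[p] ≅ W_K[p]`, local lemma (H) at the good places) ⟹ `Sel_𝔭^∅` finite ⟹ `X_ac^∅(W_K)` torsion with
`Ch_Λ·R₀⟦T⟧ = (g)`, `g` with a norm-one coefficient (Λ-side). [cite: GreenbergVatsal2000, Thm. (1.4) (algebraic half); §2 Prop. (2.4), (2.8)] -/
theorem isTorsion_and_exists_generator_empty_transfer_of_modPCongruent (hp : p ≠ 2)
    (h𝔭 : ((p : ℕ) : 𝓞 K) ∈ 𝔭.asIdeal) (h𝔭dec : ¬ (decomp 𝔭 ≤ κ.kerSubgroup)) (hSfin : S.Finite)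
    (hSp : ∀ v ∈ S, ((p : ℕ) : 𝓞 K) ∉ v.asIdeal) (hSdec : ∀ v ∈ S, ¬ (decomp v ≤ κ.kerSubgroup))
    (hgood : ∀ v : HeightOneSpectrum (𝓞 K), v ∉ S → ((p : ℕ) : 𝓞 K) ∉ v.asIdeal →
      (W.baseChange K).HasGoodReductionAt v)
    (hgood' : ∀ v : HeightOneSpectrum (𝓞 K), v ∉ S → ((p : ℕ) : 𝓞 K) ∉ v.asIdeal →
      (W'.baseChange K).HasGoodReductionAt v)
    (hcong : ModPCongruent W' W p)
    (hT' : Module.IsTorsion (IwasawaAlgebra p) (XAc (W'.baseChange K) p κ 𝔭 ∅ γ))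
    (hg' : ∃ g : UnrSeries p,
      (XAc.charIdeal (W'.baseChange K) p κ 𝔭 ∅ γ).map (PowerSeries.map (Halves.toUnr p)) =
          Ideal.span {g} ∧
        ∃ i : ℕ, ‖((PowerSeries.coeff i g : unrIntegers p) : ℂ_[p])‖ = 1) :
    Module.IsTorsion (IwasawaAlgebra p) (XAc (W.baseChange K) p κ 𝔭 ∅ γ) ∧
      ∃ g : UnrSeries p,
        (XAc.charIdeal (W.baseChange K) p κ 𝔭 ∅ γ).map (PowerSeries.map (Halves.toUnr p)) =
            Ideal.span {g} ∧
          ∃ i : ℕ, ‖((PowerSeries.coeff i g : unrIntegers p) : ℂ_[p])‖ = 1 := by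
  -- twin: `Sel^∅[p]` finite, then `Sel^Σ[p]` finite
  have h1 : Set.Finite {s : selmerAc (W'.baseChange K) p κ 𝔭 ∅ | p • s = 0} :=
    finite_pTorsion_of_isTorsion_of_exists_generator (W'.baseChange K) p κ 𝔭 ∅ γ Set.finite_empty hT' hg'
  have h2 : Set.Finite {s : selmerAc (W'.baseChange K) p κ 𝔭 S | p • s = 0} :=
    finite_selmerAc_pTorsion_of_empty (W'.baseChange K) κ hSfin hSp hSdec h1
  -- residual comparison at `Σ`
  obtain ⟨e, he⟩ := exists_torsionIso_baseChange_of_modPCongruent W W' K hcong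
  have h3 : Set.Finite {s : selmerAc (W.baseChange K) p κ 𝔭 S | p • s = 0} :=
    finite_selmerAc_pTorsion_transfer_of_torsionIso κ (W'.baseChange K) (W.baseChange K) hp h𝔭 h𝔭dec
      hgood' hgood e he h2
  -- back to `Σ = ∅` and to `Λ`
  have h4 : Set.Finite {s : selmerAc (W.baseChange K) p κ 𝔭 ∅ | p • s = 0} :=
    finite_selmerAc_pTorsion_empty_of (W.baseChange K) κ h3
  exact isTorsion_and_exists_generator_of_finite_pTorsion (W.baseChange K) p κ 𝔭 ∅ γ
    Set.finite_empty h4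

end Summit.BirchSwinnertonDyer.BirchSwinnertonDyer.Theorems.UniversalToricDescentTorsionMuTransport

end
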